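import Summits.BirchSwinnertonDyer.Rank1Residual.Additive.GoodModelReductionDatum
import HarnessLib

/-!
# Inertia fixes the roots of unity of order prime to `p`; Kummer: `σ^e` fixes `u` when `u^e = p^m`
# (cell `b2b-bsdres`, team n1011, seat p07 (gen 7); row T-ROL-EXP FILE A1 — the Galois-theoretic
# input of the explicit Kummer–Deuring good model `Additive/KummerDeuringModel.lean`)

HONEST FRAMING (cell `b2b-bsdres`, run/shared/lean/b2b/bsd-rank1-residual/, verbatim in every
file): the goal of the cell is to DELETE the COMBINATION-SHAPED residual classes of the
Birch–Swinnerton-Dyer formula for ALL analytic-rank `≤ 1` elliptic curves over `ℚ` — "full BSD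
formula for every rank `≤ 1` curve in class `C`" assembled STRICTLY from published theorems — so
that the rank-`≤ 1` remainder becomes exactly the CONSTRUCTION-SHAPED classes, which are TYPED
(missing-input `Prop`s), NOT attempted. This is not "finishing BSD". Team n1011 (N10/N11): research
route on the CONSTRUCTION-SHAPED classes X3♯(G-ord)/X4♯(G-ord); prove what is provable now; no
claim beyond stated classes; census output = EVIDENCE, never a Literature fact; RESIDUAL-MAP marks
UNCHANGED; nothing is booked by this file. TOOL theorems only: NO definition, NO named fact.

## What and why

For the local inertia group `I_v ≤ Γ_{ℚ_v}` acting on `K̄_v` (`v ∋ p`), with the spectral valuation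
`w` of X2's `specVal`:
* `eq_one_of_pow_eq_one_of_residue_eq_one` — in a local domain an `e`-th root of unity `≡ 1 (mod 𝔪)`
  is `1` when `e ≠ 0` in the residue field (`∑_{i<e} x^i` has residue `e`);
* `eq_one_of_pow_eq_one_of_specVal_sub_one_lt` — the same in `K̄_v`: `ζ^e = 1`, `|ζ − 1|_v < 1`,
  `p ∤ e` ⟹ `ζ = 1` (residue characteristic `p`, p05's `charP_residueField_specVal`);
* **`pow_smul_eq_of_pow_eq_natCast_pow`** — KUMMER: if `u^e = p^m` and `p ∤ e` then `σ^e • u = u`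
  for every `σ ∈ I_v`: `ζ = σ(u)/u` is an `e`-th root of unity, `σ(ζ)/ζ` an `e`-th root of unity
  `≡ 1` (σ inertial, ζ a unit), so `σ(ζ) = ζ`, `σ^k(u) = ζ^k u`, `σ^e(u) = u`. No root of unity in
  `ℚ_v` is used.
This is the input "`σ^e` fixes the change of variables" of the explicit good model of FILE A2, from
which FILE B reads the inertia exponent `e` of the ramified ordinary line on the (G-ord) rows.

References: J.-P. Serre, *Local Fields*, IV §1–§2 (inertia, tame ramification) [SerreLocalFields1979];
J. H. Silverman, *AEC* VII.5.5 [SilvermanAEC2009]; cells/n1011/skel/T-ROL-EXP.md (67779f27699eb635).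
-/

set_option autoImplicit false

noncomputable section

open scoped Classical NNReal NumberField

universe u

namespace Summit.BirchSwinnertonDyer.Rank1Residual.Additive.GoodModelLine

open NumberField IsDedekindDomain Field IsDedekindDomain.HeightOneSpectrum
  Literature.NumberTheory.GaloisRepresentations Literature.NumberTheory.EllipticCurves
  Summit.BirchSwinnertonDyer.Rank1Residual.X2.GreenbergVatsalReductionDatum

/-! ## §1 Roots of unity of order prime to the residue characteristic are separated mod `𝔪` -/

/-- **An `e`-th root of unity `≡ 1 (mod 𝔪)` is `1` when `e` is invertible in the residue field.**
In a local domain `O`: `x^e = 1`, `x ≡ 1 (mod 𝔪)`, `(e : O/𝔪) ≠ 0` ⟹ `x = 1`. (If `x ≠ 1`,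
`∑_{i<e} x^i = (x^e − 1)/(x − 1) = 0`, whose residue is `∑_{i<e} 1 = e`.) [folklore] -/
theorem eq_one_of_pow_eq_one_of_residue_eq_one {O : Type*} [CommRing O] [IsDomain O] [IsLocalRing O]
    {x : O} {e : ℕ} (hx : x ^ e = 1) (hres : IsLocalRing.residue O x = 1)
    (he : (e : IsLocalRing.ResidueField O) ≠ 0) : x = 1 := by
  by_contra h
  have h1 : (∑ i ∈ Finset.range e, x ^ i) * (x - 1) = 0 := by rw [geom_sum_mul, hx, sub_self]
  have h2 : ∑ i ∈ Finset.range e, x ^ i = 0 :=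
    (mul_eq_zero.mp h1).resolve_right (sub_ne_zero.mpr h)
  have h3 := congrArg (IsLocalRing.residue O) h2
  rw [map_sum, map_zero] at h3
  simp only [map_pow, hres, one_pow, Finset.sum_const, Finset.card_range, nsmul_eq_mul, mul_one] at h3
  exact he h3

section Local

variable (p : ℕ) [hp : Fact p.Prime] {v : HeightOneSpectrum (𝓞 ℚ)}

/-- **In `K̄_v` (`v ∋ p`): an `e`-th root of unity `ζ` with `|ζ − 1|_v < 1` and `p ∤ e` is `1`.**
(§1 in the valuation ring `𝒪_w` of the spectral valuation; residue characteristic `p`,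
`charP_residueField_specVal`.) [folklore] -/
theorem eq_one_of_pow_eq_one_of_specVal_sub_one_lt (hpv : ((p : ℕ) : 𝓞 ℚ) ∈ v.asIdeal)
    {ζ : AlgebraicClosure (v.adicCompletion ℚ)} {e : ℕ} (he0 : e ≠ 0) (hζe : ζ ^ e = 1)
    (hζ1 : specVal v (ζ - 1) < 1) (hpe : ¬ p ∣ e) : ζ = 1 := by
  have hvO : (specVal v).Integers (specVal v).valuationSubring := Valuation.valuationSubring.integers _
  haveI := charP_residueField_specVal p hpv
  have hwζ : specVal v ζ = 1 := by
    have h : specVal v ζ ^ e = 1 := by rw [← map_pow, hζe, map_one]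
    exact ((pow_eq_one_iff.mp h).resolve_right he0)
  set x : (specVal v).valuationSubring := ⟨ζ, (Valuation.mem_valuationSubring_iff _ _).mpr hwζ.le⟩
    with hxdef
  have hxe : x ^ e = 1 := Subtype.ext (by rw [SubmonoidClass.coe_pow, hxdef, hζe]; rfl)
  have hres : IsLocalRing.residue _ x = 1 := by
    rw [← map_one (IsLocalRing.residue (specVal v).valuationSubring), ← sub_eq_zero, ← map_sub,
      IsLocalRing.residue_eq_zero_iff, IsLocalRing.mem_maximalIdeal, mem_nonunits_iff,
      hvO.isUnit_iff_valuation_eq_one]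
    exact ne_of_lt (by simpa [hxdef] using hζ1)
  have hek : (e : IsLocalRing.ResidueField (specVal v).valuationSubring) ≠ 0 := by
    rw [Ne, CharP.cast_eq_zero_iff _ p]
    exact hpe
  have := eq_one_of_pow_eq_one_of_residue_eq_one hxe hres hek
  simpa [hxdef] using congrArg Subtype.val this

/-- **Kummer: `σ^e` fixes `u` when `u^e = p^m`, for every local inertia element `σ`** (`p ∤ e`).
`ζ := σ(u)/u` satisfies `ζ^e = 1`; `σ(ζ)/ζ` is an `e`-th root of unity `≡ 1 (mod 𝔪)` since `σ` is
inertial and `ζ` a unit, so `σ(ζ) = ζ`; hence `σ^k(u) = ζ^k u` and `σ^e(u) = ζ^e u = u`. No root of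
unity in `ℚ_v` is needed. [folklore] -/
theorem pow_smul_eq_of_pow_eq_natCast_pow (hpv : ((p : ℕ) : 𝓞 ℚ) ∈ v.asIdeal)
    {u : AlgebraicClosure (v.adicCompletion ℚ)} {e m : ℕ} (he0 : e ≠ 0) (hpe : ¬ p ∣ e)
    (hu : u ^ e = (p : AlgebraicClosure (v.adicCompletion ℚ)) ^ m)
    {σ : absoluteGaloisGroup (v.adicCompletion ℚ)} (hσ : σ ∈ absInertia (v.adicCompletion ℚ)) :
    (σ ^ e) • u = u := by
  obtain ⟨𝔐, h𝔐⟩ := v.localPrimesAbove_nonempty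
  set ψ : AlgebraicClosure (v.adicCompletion ℚ) ≃ₐ[v.adicCompletion ℚ] AlgebraicClosure (v.adicCompletion ℚ) :=
    absoluteGaloisGroup.toAlgEquiv _ σ with hψ
  have hσI' : σ ∈ 𝔐.inertia (absoluteGaloisGroup (v.adicCompletion ℚ)) := by
    rw [inertia_eq_absInertia (specVal_spec v) h𝔐]; exact hσ
  have hσI : ∀ z, specVal v z ≤ 1 → specVal v (ψ z - z) < 1 :=
    (mem_inertia_iff_spectralValuation (specVal_spec v) h𝔐).1 hσI'
  haveI : CharZero (AlgebraicClosure (v.adicCompletion ℚ)) :=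
    charZero_of_injective_algebraMap (algebraMap ℚ _).injective
  have hp0 : (p : AlgebraicClosure (v.adicCompletion ℚ)) ≠ 0 := Nat.cast_ne_zero.mpr hp.out.ne_zero
  have hu0 : u ≠ 0 := by
    intro h
    rw [h, zero_pow he0] at hu
    exact pow_ne_zero m hp0 hu.symm
  have hψp : ψ ((p : AlgebraicClosure (v.adicCompletion ℚ)) ^ m) = (p : _) ^ m := by
    rw [map_pow, map_natCast]
  -- `ζ = σ(u)/u`, an `e`-th root of unity
  set ζ : AlgebraicClosure (v.adicCompletion ℚ) := ψ u * u⁻¹ with hζ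
  have hψu : ψ u = ζ * u := by rw [hζ, inv_mul_cancel_right₀ hu0]
  have hζe : ζ ^ e = 1 := by
    rw [hζ, mul_pow, ← map_pow, hu, hψp, inv_pow, hu, mul_inv_cancel₀ (pow_ne_zero m hp0)]
  have hwζ : specVal v ζ = 1 := by
    have h : specVal v ζ ^ e = 1 := by rw [← map_pow, hζe, map_one]
    exact ((pow_eq_one_iff.mp h).resolve_right he0)
  have hζ0 : ζ ≠ 0 := fun h ↦ by
    rw [h, zero_pow he0] at hζe; exact zero_ne_one hζe
  -- `σ(ζ) = ζ`
  have hψζ : ψ ζ = ζ := by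
    set η : AlgebraicClosure (v.adicCompletion ℚ) := ψ ζ * ζ⁻¹ with hη
    have hηe : η ^ e = 1 := by
      rw [hη, mul_pow, ← map_pow, hζe, map_one, inv_pow, hζe, inv_one, mul_one]
    have hη1 : specVal v (η - 1) < 1 := by
      have h1 : η - 1 = (ψ ζ - ζ) * ζ⁻¹ := by
        rw [hη, sub_mul, mul_inv_cancel₀ hζ0]
      rw [h1, map_mul, map_inv₀, hwζ, inv_one, mul_one]
      exact hσI ζ hwζ.le
    have hη' : η = 1 := eq_one_of_pow_eq_one_of_specVal_sub_one_lt p hpv he0 hηe hη1 hpe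
    have : ψ ζ = η * ζ := by rw [hη, inv_mul_cancel_right₀ hζ0]
    rw [this, hη', one_mul]
  -- `σ^k(u) = ζ^k u`
  have hiter : ∀ k : ℕ, (ψ ^ k) u = ζ ^ k * u := by
    intro k
    induction k with
    | zero => rw [pow_zero, pow_zero, one_mul, AlgEquiv.one_apply]
    | succ k ih =>
      rw [pow_succ', AlgEquiv.mul_apply, ih, map_mul, map_pow, hψζ, hψu, pow_succ]
      ring
  rw [absoluteGaloisGroup.smul_def, map_pow, ← hψ, hiter e, hζe, one_mul]


end Local

end Summit.BirchSwinnertonDyer.Rank1Residual.Additive.GoodModelLine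

end
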